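import Summits.BirchSwinnertonDyer.Rank1Residual.Supersingular.KobayashiMainConjectureX7FouquetWanCrystalline
import HarnessLib

/-!
# Route `SignedLowerHalves`, crux `KobayashiLowerHalfLargeImage` (item stmt-BirchSwinnertonDyer-19001): the
# registered stub `stub_fwLocus`, VERBATIM, in EITHER analytic rank and at EVERY odd `p`, closed MODULO the
# WEAKER Fouquet–Wan binder «Thm 4.51 (§4.6 crystalline chain, with Kato's (12.5.2)) ∘ Kobayashi Thm 7.4»
# (cell `bsd-ssimc`, seat `bsd-ssimc-k3-c3` gen 0, order W-lev-9 part 2; a `--supports … --as helper` file,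
# closes nothing)

PARTITION (cell bsd-ssimc): X7 (A7) × the Fouquet–Wan locus (1 004 of the 1 417 open X7 pairs of the cell
window, both ranks; 150 of them at `p = 3`) — types-the-object-of; closes NONE. THEOREMS ONLY.

Companion of `SignedLowerHalvesKobayashiLowerHalfLargeImageFWLocusAllRanks.lean` (p414676, seat lev g5:
the same stub modulo the §5 binder `FouquetWan2021_thm51_via_kobayashi74_OPEN`). Here the hypothesis is the
WEAKER binder `FouquetWan2021_thm451_via_kobayashi74_OPEN`
(`Supersingular/KobayashiMainConjectureX7FouquetWanCrystalline.lean`): Fouquet–Wan arXiv:2107.13726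
Thm 4.51 = Thm 1.13 — the §4.6 chain (Greenberg containment over an auxiliary `K` by the U(3,1) Eisenstein
congruences of §7 ⇒ IMC up to powers of `p` by Beilinson–Flach classes ⇒ powers of `p` by the unramified
one-variable family) — WITH the SL₂(ℤ_p)-image hypothesis (Kato's (12.5.2)) that its proof invokes and its
printed statement omits, read through Kobayashi 2003 Thm 7.4. That chain — not the §5 universal-deformation
argument of Thm 5.1 — is what the cell's audit W-lev-9 (lev MEMO-5 + addA–D, REPORT-lev-7 PASS; this seat's
MEMO-1) reads line by line. The extra hypothesis is DISCHARGED in the kernel on the whole X7 ∩ {surj(p)}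
branch at EVERY odd `p`: `ClassX7.imageContainsSL2_of_surj` (Serre's lifting lemma at `p ≥ 5`; Wuthrich
2014 Lemma 20 — a tree theorem — at a good supersingular `3`). Consequently the audit flag A-KATO-3 of
MEMO-5-addB (150 locus pairs at `p = 3`) is VOID: no `3`-adic certificate and no §5 route is needed on X7.
The statement below is the planner's registered stub header VERBATIM (BC3 skeleton
`Cruxes/KobayashiLowerHalfLargeImage/Lines/birth.lean`, sha16 cce22a86407317b7) with ONE extra leading
binder, the OPEN claim; since `thm451_OPEN_of_thm51_OPEN`, it implies p414676's `stub_fwLocus_of_thm51_OPEN`.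
Nothing is booked; the crux stays OPEN on the ledger.

References: [FouquetWan2021] Thm 4.51 / 1.13 (PRE); [Kobayashi2003] Thm 7.4 (p. 13), Conjecture (p. 2);
[Wuthrich2014] Lemma 20 (p. 399); [Kato2004Asterisque] (12.5.2) p. 222.
-/

set_option autoImplicit false
set_option linter.dupNamespace false

noncomputable section

open scoped Classical MatrixGroups ModularForm

open CongruenceSubgroup WeierstrassCurve Literature.NumberTheory.EllipticCurves
  Literature.NumberTheory.EllipticCurves.ModularForms
  Literature.NumberTheory.EllipticCurves.Rank1Residual
  Summit.BirchSwinnertonDyer.Rank1Residual.Supersingular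

namespace Summit.BirchSwinnertonDyer.BirchSwinnertonDyer.Theorems

/-- **`stub_fwLocus` (verbatim header) MODULO the weaker OPEN binder «FW Thm 4.51 ∘ Kobayashi Thm 7.4».**
For every globally minimal `W/ℚ` and odd prime `p` with `ClassX7 W p`, `¬CM`, `a_p = 0`, `ρ̄_{E,p}` onto
and a prime `ℓ ≠ p` of NON-SPLIT multiplicative reduction with `p ∤ ord_ℓ(Δ_min)`: IF
`FouquetWan2021_thm451_via_kobayashi74_OPEN` holds (`hFW`, the Fouquet–Wan half UNREFEREED), then
`∃ ε, KobayashiLowerDivisibility W p ε` (indeed the full main conjecture for both signs). The binder `Surj`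
is USED — it supplies Kato's (12.5.2) through `ClassX7.imageContainsSL2_of_surj` at every odd `p` — and
`¬CM` is carried unused. CONDITIONAL; closes nothing. [claim: FouquetWan2021, status: under-review]
[cite: Kobayashi2003, Thm. 7.4 (p. 13) and Conjecture (p. 2)] [cite: Wuthrich2014, Lemma 20 (p. 399)] -/
theorem stub_fwLocus_of_thm451_OPEN (hFW : FouquetWan2021_thm451_via_kobayashi74_OPEN) :
    ∀ (W : WeierstrassCurve ℚ) [W.IsElliptic] [W.IsGloballyMinimal] (p : ℕ) [Fact p.Prime],
      p ≠ 2 → ClassX7 W p → ¬ W.HasCM → W.frobeniusTrace p = 0 → Surj W p →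
      (∃ ℓ : ℕ, ∃ _ : Fact ℓ.Prime, ℓ ≠ p ∧ W.HasMultiplicativeReductionAtPrime ℓ ∧
          ¬ W.HasSplitMultiplicativeReductionAtPrime ℓ ∧ ¬ p ∣ padicValInt ℓ W.minimalDiscriminantInt) →
      ∃ ε : ℤˣ, Summit.BirchSwinnertonDyer.Rank1Residual.Supersingular.KobayashiLowerDivisibility W p ε := by
  intro W _ _ p _ hp hX _hcm hap hs hloc
  exact X7.kobayashiLowerDivisibility_of_thm451_OPEN W p hFW hp hX hap hs hloc

/-- **The whole FW locus of corner X7 ∩ {surj(p)}, analytic rank ≤ 1, every odd `p`: `BSD(E,p)` MODULO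
the weaker binder**, by cases on the rank — rank 1 via Burungale–Kobayashi–Ota 2024 Cor A.5 (`hA5`), rank 0
via the image-free ± road (Kobayashi Thm 1.2 `h12`, B. D. Kim Cor 3.15 `hKim`, Pollack `hPollack`,
modularity `hmod`/`hmod'`), GZK (`hGZK`) in both. CONDITIONAL; closes nothing.
[claim: FouquetWan2021, status: under-review] [cite: BurungaleKobayashiOta2023, App. A Cor. A.5]
[cite: Kobayashi2003, Thm. 1.2 and Thm. 7.4] [cite: BDKim2013, Cor. 3.15 (p. 199)] [cite: Miller2011LMS, §1 and Def. 1.1] -/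
theorem X7_bsdp_of_thm451_OPEN_of_fwLocus_of_surj_of_analyticRank_le_one
    (hFW : FouquetWan2021_thm451_via_kobayashi74_OPEN)
    (hA5 : BurungaleKobayashiOta2024.corA5_pPart_of_signedCharIdeal_eq)
    (h12 : Kobayashi2003.thm12_signedSelmerDual_finite_torsion)
    (hKim : BDKim2013.cor315_signedCharValue_rankZero)
    (hmod : nonempty_modularParametrizationData) (hmod' : hasEntireLFunction_rat)
    (hGZK : rank_eq_analyticRank_of_analyticRank_le_one)
    (W : WeierstrassCurve ℚ) [W.IsElliptic] [W.IsGloballyMinimal] (p : ℕ) [Fact p.Prime]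
    (hPollack : ∀ {N : ℕ} [NeZero N] {f : CuspForm (Gamma0 N) 2},
      pollack_exists_plusMinusPAdicLFunction (W := W) (f := f) (p := p))
    (hp : p ≠ 2) (hX : ClassX7 W p) (hap : W.frobeniusTrace p = 0) (hs : Surj W p)
    (hloc : ∃ (ℓ : ℕ) (_ : Fact ℓ.Prime), ℓ ≠ p ∧ W.HasMultiplicativeReductionAtPrime ℓ ∧
        ¬ W.HasSplitMultiplicativeReductionAtPrime ℓ ∧ ¬ p ∣ padicValInt ℓ W.minimalDiscriminantInt)
    (hr : W.analyticRank ≤ 1) : BSDp W p := by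
  rcases Nat.lt_or_ge W.analyticRank 1 with h0 | h1
  · exact X7.bsdp_of_thm451_OPEN_of_analyticRank_eq_zero W p hFW h12 hKim hPollack hmod hmod' hGZK hp hX
      hap hs hloc (Nat.lt_one_iff.mp h0)
  · exact X7.bsdp_of_thm451_OPEN_of_corA5_of_analyticRank_eq_one W p hFW hA5 hmod' hGZK hp hX hap hs hloc
      (le_antisymm hr h1)

end Summit.BirchSwinnertonDyer.BirchSwinnertonDyer.Theorems

end
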